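import Mathlib
import HarnessLib

/-!
# The Stickelberger ideal of `ℤ[Gal(ℚ(ζ_p)/ℚ)]` [Schoof2009, Chapter 9]: the group-ring identities

Let `p` be an odd prime and `G = Gal(ℚ(ζ_p)/ℚ) = {σ_a : a ∈ (ℤ/pℤ)ˣ}`, `σ_a(ζ_p) = ζ_p^a`. We work in
the group ring `ℤ[G]`, realised as `MonoidAlgebra ℤ (ZMod p)ˣ` (`σ_a = single a 1`; this is
Mathlib's `IsCyclotomicExtension.autEquivPow`-identification of the Galois group with `(ℤ/pℤ)ˣ`).
Following R. Schoof, *Catalan's Conjecture* (Universitext 2009), Chapter 9, we define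

* `Stickelberger.theta p i` — `θ_i = ∑_{a=1}^{p-1} ⌊i a / p⌋ σ_a⁻¹` (`i ∈ ℕ`; the book allows
  `i ∈ ℤ`, which by the periodicity `θ_{p+i} = θ_i + θ_p` changes nothing), in particular the
  Stickelberger element `θ_p = ∑ a σ_a⁻¹` (`Stickelberger.coeff_theta_p`);
* `Stickelberger.trace p` — the `G`-trace `T = ∑ σ_a`; `Stickelberger.iota p` — `ι = σ_{-1}`;
* `Stickelberger.f p i = θ_{i+1} - θ_i`, `Stickelberger.e p i = (1 - ι) f_i`;
* `Stickelberger.stickelbergerIdeal p` — **the Stickelberger ideal** `S ⊆ ℤ[G]`, generated by the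
  `θ_i` [Schoof2009, Ch. 9, Definition]; `Stickelberger.idealI p = S · (1 - ι)`, the ideal `I` of
  [Schoof2009, Theorem 9.3 (ii)] used in Chapters 10 and 11;

and prove [Schoof2009, Lemma 9.1] (`theta_add`, `natCast_mul_theta`, `theta_add_theta_sub`,
`single_mul_theta`), `T ∈ S` (`trace_eq`, `trace_mem`; part of Proposition 9.2),
[Schoof2009, Exercises 9.3, 9.4] (`coeff_f_mem`, `one_add_iota_mul_f`) and
**[Schoof2009, Proposition 9.4]**: every coefficient of `e_i` (`1 ≤ i ≤ p - 2`) is `±1`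
(`coeff_e_mem`), so that `e_i ∈ I` has no coefficient divisible by any `q ≥ 2`
(`not_dvd_coeff_e`, `e_mem`) — the input from Chapter 9 to the proof of [Schoof2009,
Theorem 10.2] (`q² ∣ x`, Mihăilescu's Theorem I). Stickelberger's theorem itself
([Schoof2009, Theorems 9.5, 9.6]: `S` annihilates the class group of `ℚ(ζ_p)`) and the `ℤ`-rank
statement [Schoof2009, Theorem 9.3] are not in this file.

Everything here is proved; the only definitions are the explicit elements and ideals above.
-/

open MonoidAlgebra Finset

namespace Literature.NumberTheory.NumberFields

namespace Stickelberger

variable (p : ℕ) [hp : Fact p.Prime]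

/-- `Stickelberger.quot p i a = ⌊i a / p⌋`, where `a ∈ (ℤ/pℤ)ˣ` is represented by an integer in
`[1, p-1]`: the coefficient `n_{i,a}` of `σ_a⁻¹` in `θ_i` [Schoof2009, Ch. 9, p. 61].
[cite: Schoof2009, Ch. 9, Definition (p. 58)] -/
def quot (i : ℕ) (a : (ZMod p)ˣ) : ℕ := i * (a : ZMod p).val / p

/-- **The elements `θ_i`** of `ℤ[G]`, `G = (ℤ/pℤ)ˣ ≅ Gal(ℚ(ζ_p)/ℚ)`:
`θ_i = ∑_{a=1}^{p-1} ⌊i a / p⌋ σ_a⁻¹` (`σ_a = single a 1`); `θ_p = ∑ a σ_a⁻¹` is the Stickelberger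
element. [cite: Schoof2009, Ch. 9, Definition (p. 58)] -/
noncomputable def theta (i : ℕ) : MonoidAlgebra ℤ (ZMod p)ˣ :=
  .ofCoeff (Finsupp.equivFunOnFinite.symm fun b => ((quot p i b⁻¹ : ℕ) : ℤ))

/-- The `G`-trace `T = ∑_{a} σ_a ∈ ℤ[G]`. [cite: Schoof2009, Ch. 9, Definition (p. 59)] -/
noncomputable def trace : MonoidAlgebra ℤ (ZMod p)ˣ :=
  .ofCoeff (Finsupp.equivFunOnFinite.symm fun _ => 1)

/-- Complex conjugation `ι = σ_{-1} ∈ ℤ[G]`. [cite: Schoof2009, Ch. 7 (p. 41)] -/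
noncomputable def iota : MonoidAlgebra ℤ (ZMod p)ˣ := single (-1) 1

/-- `f_i = θ_{i+1} - θ_i`. [cite: Schoof2009, Ch. 9, Definition (p. 59)] -/
noncomputable def f (i : ℕ) : MonoidAlgebra ℤ (ZMod p)ˣ := theta p (i + 1) - theta p i

/-- `e_i = (1 - ι) f_i`. [cite: Schoof2009, Ch. 9, Definition (p. 59)] -/
noncomputable def e (i : ℕ) : MonoidAlgebra ℤ (ZMod p)ˣ := (1 - iota p) * f p i

/-- **The Stickelberger ideal** `S`: the ideal of `ℤ[G]` generated by the elements `θ_i`.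
[cite: Schoof2009, Ch. 9, Definition (p. 58)] -/
noncomputable def stickelbergerIdeal : Ideal (MonoidAlgebra ℤ (ZMod p)ˣ) :=
  Ideal.span (Set.range (theta p))

/-- The ideal `I = S · (1 - ι)` of `ℤ[G]` (the product of the Stickelberger ideal and the element
`1 - ι`). [cite: Schoof2009, Theorem 9.3 (ii)] -/
noncomputable def idealI : Ideal (MonoidAlgebra ℤ (ZMod p)ˣ) :=
  stickelbergerIdeal p * Ideal.span {1 - iota p}

variable {p}

/-- The coefficient of `σ_b` in `θ_i` is `⌊i b⁻¹ / p⌋` (i.e. that of `σ_a⁻¹` is `⌊i a/p⌋`). [folklore] -/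
@[simp] theorem coeff_theta (i : ℕ) (b : (ZMod p)ˣ) :
    (theta p i).coeff b = ((quot p i b⁻¹ : ℕ) : ℤ) := rfl

/-- Every coefficient of `T` is `1`. [folklore] -/
@[simp] theorem coeff_trace (b : (ZMod p)ˣ) : (trace p).coeff b = 1 := rfl

/-- The representative of a unit of `ℤ/pℤ` in `[0, p)` is positive. [folklore] -/
theorem val_pos (a : (ZMod p)ˣ) : 0 < (a : ZMod p).val := by
  rw [Nat.pos_iff_ne_zero, Ne, ZMod.val_eq_zero]
  exact a.ne_zero

/-- The representative of a unit of `ℤ/pℤ` in `[0, p)` is `< p`. [folklore] -/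
theorem val_lt (a : (ZMod p)ˣ) : (a : ZMod p).val < p := ZMod.val_lt _

/-- The floor identity behind [Schoof2009, Lemma 9.1 (iii) and Exercise 9.4]: for `0 < x, y < p`
(`p` prime), `⌊x y / p⌋ + ⌊(p - x) y / p⌋ = y - 1` (as `p ∤ x y`). [folklore] -/
theorem div_add_sub_mul_div {x y : ℕ} (hx0 : 0 < x) (hxp : x < p) (hy0 : 0 < y) (hyp : y < p) :
    x * y / p + (p - x) * y / p = y - 1 := by
  have hpp := hp.out
  have hp0 : 0 < p := hpp.pos
  set k := x * y / p with hk
  set r := x * y % p with hr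
  have h1 : r + p * k = x * y := Nat.mod_add_div _ _
  have hr0 : 0 < r := by
    rw [hr, Nat.pos_iff_ne_zero]
    intro h0
    have : p ∣ x * y := Nat.dvd_of_mod_eq_zero h0
    rcases (Nat.Prime.dvd_mul hpp).mp this with h | h
    · exact absurd (Nat.le_of_dvd hx0 h) (by omega)
    · exact absurd (Nat.le_of_dvd hy0 h) (by omega)
  have hrp : r < p := by rw [hr]; exact Nat.mod_lt _ hp0
  have hky : k < y := by
    rw [hk, Nat.div_lt_iff_lt_mul hp0]
    calc x * y < p * y := Nat.mul_lt_mul_of_pos_right hxp hy0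
      _ = y * p := mul_comm _ _
  have h2 : (p - x) * y = (p - r) + p * (y - k - 1) := by
    have e1 : (p - x) * y + x * y = p * y := by
      rw [← Nat.add_mul, Nat.sub_add_cancel hxp.le]
    have e2 : p * (y - k - 1) + p * k + p = p * y := by
      rw [← Nat.mul_add, ← Nat.mul_succ]
      congr 1
      omega
    omega
  rw [h2, Nat.add_mul_div_left _ _ hp0, Nat.div_eq_of_lt (by omega : p - r < p)]
  omega

/-- `⌊p a / p⌋ = a`: the coefficients of the Stickelberger element `θ_p`. [folklore] -/
@[simp] theorem quot_p (a : (ZMod p)ˣ) : quot p p a = (a : ZMod p).val := by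
  rw [quot, Nat.mul_div_cancel_left _ hp.out.pos]

/-- `θ_0 = 0` coefficientwise. [cite: Schoof2009, Exercise 9.2] -/
@[simp] theorem quot_zero (a : (ZMod p)ˣ) : quot p 0 a = 0 := by simp [quot]

/-- `θ_1 = 0` coefficientwise (`⌊a/p⌋ = 0` for `a < p`). [cite: Schoof2009, Exercise 9.2] -/
@[simp] theorem quot_one (a : (ZMod p)ˣ) : quot p 1 a = 0 := by
  rw [quot, one_mul, Nat.div_eq_of_lt (val_lt a)]

/-- **[Schoof2009, Lemma 9.1 (i)]**: `θ_{p+i} = θ_i + θ_p`. [cite: Schoof2009, Lemma 9.1 (i)] -/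
theorem theta_add (i : ℕ) : theta p (p + i) = theta p i + theta p p := by
  ext b
  simp only [coeff_theta, coeff_add, Finsupp.coe_add, Pi.add_apply, quot_p]
  rw [quot, Nat.add_mul, Nat.add_comm, Nat.add_mul_div_left _ _ hp.out.pos, quot]
  push_cast
  ring

/-- `θ_0 = 0`. [cite: Schoof2009, Exercise 9.2] -/
@[simp] theorem theta_zero : theta p 0 = 0 := by
  ext b; simp

/-- `θ_1 = 0`. [cite: Schoof2009, Exercise 9.2] -/
@[simp] theorem theta_one : theta p 1 = 0 := by
  ext b; simp

/-- The Stickelberger element: the coefficient of `σ_b` in `θ_p` is (the representative in `[1, p-1]`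
of) `b⁻¹`, i.e. `θ_p = ∑_a a σ_a⁻¹`. [cite: Schoof2009, Ch. 9, Definition (p. 58)] -/
theorem coeff_theta_p (b : (ZMod p)ˣ) : (theta p p).coeff b = ((b⁻¹ : (ZMod p)ˣ) : ZMod p).val := by
  rw [coeff_theta, quot_p]

/-- Multiplication by `σ_u` permutes coefficients: `(σ_u x)_b = x_{u⁻¹ b}`. [folklore] -/
theorem coeff_single_mul (u b : (ZMod p)ˣ) (x : MonoidAlgebra ℤ (ZMod p)ˣ) :
    (single u (1 : ℤ) * x).coeff b = x.coeff (u⁻¹ * b) := by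
  rw [coeff_single_mul_apply, one_mul]

/-- `(n x)_b = n x_b` for a natural number `n`. [folklore] -/
theorem coeff_natCast_mul (n : ℕ) (b : (ZMod p)ˣ) (x : MonoidAlgebra ℤ (ZMod p)ˣ) :
    ((n : MonoidAlgebra ℤ (ZMod p)ˣ) * x).coeff b = n * x.coeff b := by
  rw [natCast_def, coeff_single_mul_apply, inv_one, one_mul]

/-- The representative of a product of units is the product of representatives mod `p`. [folklore] -/
theorem val_mul (a b : (ZMod p)ˣ) :
    ((a * b : (ZMod p)ˣ) : ZMod p).val = ((a : ZMod p).val * (b : ZMod p).val) % p := by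
  rw [Units.val_mul, ZMod.val_mul]

/-- **[Schoof2009, Lemma 9.1 (ii)]**: `(σ_u - u) θ_p = -p θ_u` for `u ∈ (ℤ/pℤ)ˣ` (with `u` also
denoting its representative in `[1, p-1]`), stated as `p θ_u = u θ_p - σ_u θ_p`.
[cite: Schoof2009, Lemma 9.1 (ii)] -/
theorem natCast_mul_theta (u : (ZMod p)ˣ) :
    (p : MonoidAlgebra ℤ (ZMod p)ˣ) * theta p (u : ZMod p).val =
      ((u : ZMod p).val : MonoidAlgebra ℤ (ZMod p)ˣ) * theta p p - single u (1 : ℤ) * theta p p := by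
  ext b
  simp only [coeff_sub, Finsupp.coe_sub, Pi.sub_apply, coeff_natCast_mul, coeff_single_mul,
    coeff_theta, quot_p]
  rw [show (u⁻¹ * b)⁻¹ = b⁻¹ * u by rw [mul_inv_rev, inv_inv], val_mul, quot]
  set B := ((b⁻¹ : (ZMod p)ˣ) : ZMod p).val
  set U := (u : ZMod p).val
  have h := Nat.mod_add_div (B * U) p
  rw [mul_comm U B]
  have h' : (((B * U) % p : ℕ) : ℤ) + (p : ℤ) * ((B * U / p : ℕ) : ℤ) = (B : ℤ) * U := by
    exact_mod_cast h
  linear_combination h'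

/-- **[Schoof2009, Lemma 9.1 (iii)]**: `θ_i + θ_{p-i} = θ_p - T` for `1 ≤ i ≤ p - 1`.
[cite: Schoof2009, Lemma 9.1 (iii)] -/
theorem theta_add_theta_sub {i : ℕ} (hi0 : 0 < i) (hip : i < p) :
    theta p i + theta p (p - i) = theta p p - trace p := by
  ext b
  simp only [coeff_theta, coeff_add, Finsupp.coe_add, Pi.add_apply, coeff_sub, Finsupp.coe_sub,
    Pi.sub_apply, coeff_trace, quot_p]
  have h := div_add_sub_mul_div hi0 hip (val_pos b⁻¹) (val_lt b⁻¹)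
  have h1 : 1 ≤ ((b⁻¹ : (ZMod p)ˣ) : ZMod p).val := val_pos b⁻¹
  unfold quot
  have h' := congrArg (Nat.cast : ℕ → ℤ) h
  rw [Nat.cast_add, Nat.cast_sub h1] at h'
  push_cast at h' ⊢
  linarith

/-- `T = θ_p - θ_{p-1}` (Lemma 9.1 (iii) with `i = 1`, `θ_1 = 0`); in particular `T ∈ S`
[Schoof2009, Proposition 9.2]. [cite: Schoof2009, Proposition 9.2] -/
theorem trace_eq : trace p = theta p p - theta p (p - 1) := by
  have h := theta_add_theta_sub (p := p) one_pos hp.out.one_lt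
  rw [theta_one, zero_add] at h
  rw [h]; abel

/-- **[Schoof2009, Lemma 9.1 (iv)]**: `σ_u θ_i = θ_{u i} - i θ_u` (`u ∈ (ℤ/pℤ)ˣ` represented in
`[1, p-1]`, `i ∈ ℕ`). [cite: Schoof2009, Lemma 9.1 (iv)] -/
theorem single_mul_theta (u : (ZMod p)ˣ) (i : ℕ) :
    single u (1 : ℤ) * theta p i =
      theta p ((u : ZMod p).val * i) - (i : MonoidAlgebra ℤ (ZMod p)ˣ) * theta p (u : ZMod p).val := by
  ext b
  simp only [coeff_sub, Finsupp.coe_sub, Pi.sub_apply, coeff_natCast_mul, coeff_single_mul,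
    coeff_theta, quot]
  rw [show (u⁻¹ * b)⁻¹ = b⁻¹ * u by rw [mul_inv_rev, inv_inv], val_mul]
  set B := ((b⁻¹ : (ZMod p)ˣ) : ZMod p).val
  set U := (u : ZMod p).val
  rw [mul_comm U B]
  have h := Nat.mod_add_div (B * U) p
  set k := B * U / p
  set r := B * U % p
  have e1 : U * i * B = i * r + p * (i * k) := by
    calc U * i * B = i * (B * U) := by ring
      _ = i * (r + p * k) := by rw [h]
      _ = i * r + p * (i * k) := by ring
  rw [e1, Nat.add_mul_div_left _ _ hp.out.pos]
  push_cast
  ring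

/-! ### Exercises 9.3, 9.4 and Proposition 9.4 -/

/-- **[Schoof2009, Exercise 9.3]**: `⌊(i+1) a / p⌋ ≤ ⌊i a / p⌋ + 1` (so `m_{i,a} ∈ {0, 1}`).
[cite: Schoof2009, Exercise 9.3] -/
theorem quot_succ_le (i : ℕ) (a : (ZMod p)ˣ) : quot p (i + 1) a ≤ quot p i a + 1 := by
  unfold quot
  set A := (a : ZMod p).val
  have h := Nat.mod_add_div (i * A) p
  set k := i * A / p
  set r := i * A % p
  have hr : r < p := Nat.mod_lt _ hp.out.pos
  have hA : A < p := val_lt a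
  have e : (i + 1) * A = (r + A) + p * k := by rw [Nat.add_mul, one_mul, ← h]; ring
  rw [e, Nat.add_mul_div_left _ _ hp.out.pos]
  have : (r + A) / p ≤ 1 := by
    rw [Nat.div_le_iff_le_mul_add_pred hp.out.pos]
    omega
  omega

/-- `⌊i a / p⌋ ≤ ⌊(i+1) a / p⌋`. [cite: Schoof2009, Exercise 9.3] -/
theorem le_quot_succ (i : ℕ) (a : (ZMod p)ˣ) : quot p i a ≤ quot p (i + 1) a := by
  unfold quot
  exact Nat.div_le_div_right (Nat.mul_le_mul_right _ (Nat.le_succ i))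

/-- The coefficient `m_{i,a} = n_{i+1,a} - n_{i,a}` of `σ_a⁻¹` in `f_i` [Schoof2009, p. 61].
[cite: Schoof2009, Proposition 9.4 (proof)] -/
theorem coeff_f (i : ℕ) (b : (ZMod p)ˣ) :
    (f p i).coeff b = (quot p (i + 1) b⁻¹ : ℤ) - quot p i b⁻¹ := by
  simp [f]

/-- **[Schoof2009, Exercise 9.3]**: the coefficients of `f_i` are `0` or `1`. [cite: Schoof2009, Exercise 9.3] -/
theorem coeff_f_mem (i : ℕ) (b : (ZMod p)ˣ) : (f p i).coeff b = 0 ∨ (f p i).coeff b = 1 := by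
  rw [coeff_f]
  have h1 := quot_succ_le (p := p) i b⁻¹
  have h2 := le_quot_succ (p := p) i b⁻¹
  omega

/-- **[Schoof2009, Exercise 9.4]** (coefficient form): `⌊j a/p⌋ + ⌊j (p - a)/p⌋ = j - 1` for
`1 ≤ j ≤ p - 1`. [cite: Schoof2009, Exercise 9.4] -/
theorem quot_add_quot_neg {j : ℕ} (hj0 : 0 < j) (hjp : j < p) (a : (ZMod p)ˣ) :
    quot p j a + quot p j (-a) = j - 1 := by
  unfold quot
  have hneg : ((-a : (ZMod p)ˣ) : ZMod p).val = p - (a : ZMod p).val := by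
    rw [Units.val_neg, ZMod.neg_val, if_neg a.ne_zero]
  rw [hneg, mul_comm j, mul_comm j]
  exact div_add_sub_mul_div (val_pos a) (val_lt a) hj0 hjp

/-- **[Schoof2009, Exercise 9.4]**: `m_{i,a} + m_{i,p-a} = 1` for `1 ≤ i ≤ p - 2`, i.e.
`(1 + ι) f_i = T` coefficientwise. [cite: Schoof2009, Exercise 9.4] -/
theorem coeff_f_add_coeff_f_neg {i : ℕ} (hi0 : 0 < i) (hip : i + 1 < p) (b : (ZMod p)ˣ) :
    (f p i).coeff b + (f p i).coeff (-b) = 1 := by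
  rw [coeff_f, coeff_f, show (-b)⁻¹ = -b⁻¹ by rw [inv_neg]]
  have h1 := quot_add_quot_neg (p := p) hi0 (by omega) b⁻¹
  have h2 := quot_add_quot_neg (p := p) (Nat.succ_pos i) hip b⁻¹
  zify at h1 h2
  rw [Nat.cast_sub (by omega)] at h1 h2
  push_cast at h1 h2
  linarith

/-- `(ι x)_b = x_{-b}`. [folklore] -/
theorem coeff_iota_mul (b : (ZMod p)ˣ) (x : MonoidAlgebra ℤ (ZMod p)ˣ) :
    (iota p * x).coeff b = x.coeff (-b) := by
  rw [iota, coeff_single_mul_apply, one_mul, inv_neg, inv_one, neg_one_mul]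

/-- **[Schoof2009, Proposition 9.4]**, coefficient formula: `u_{i,a} = 2 m_{i,a} - 1` for the
coefficients of `e_i = (1 - ι) f_i`, `1 ≤ i ≤ p - 2`. [cite: Schoof2009, Proposition 9.4] -/
theorem coeff_e {i : ℕ} (hi0 : 0 < i) (hip : i + 1 < p) (b : (ZMod p)ˣ) :
    (e p i).coeff b = 2 * (f p i).coeff b - 1 := by
  rw [e, sub_mul, one_mul, coeff_sub, Finsupp.coe_sub, Pi.sub_apply, coeff_iota_mul]
  have := coeff_f_add_coeff_f_neg hi0 hip b
  linarith

/-- **[Schoof2009, Proposition 9.4]**: every coefficient of `e_i` (`1 ≤ i ≤ p - 2`, in particular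
`1 ≤ i ≤ (p-1)/2`) is `1` or `-1`. [cite: Schoof2009, Proposition 9.4] -/
theorem coeff_e_mem {i : ℕ} (hi0 : 0 < i) (hip : i + 1 < p) (b : (ZMod p)ˣ) :
    (e p i).coeff b = 1 ∨ (e p i).coeff b = -1 := by
  rw [coeff_e hi0 hip]
  rcases coeff_f_mem i b with h | h <;> rw [h] <;> norm_num

/-- No coefficient of `e_i` (`1 ≤ i ≤ p - 2`) is divisible by an integer `q ≥ 2` — the form in
which Proposition 9.4 enters the proof of [Schoof2009, Theorem 10.2] ("every element of `I` has all
its coefficients divisible by `q`. But this is not true"). [cite: Schoof2009, Proposition 9.4] -/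
theorem not_dvd_coeff_e {i : ℕ} (hi0 : 0 < i) (hip : i + 1 < p) (b : (ZMod p)ˣ) {q : ℤ}
    (hq : 2 ≤ q) : ¬ q ∣ (e p i).coeff b := by
  intro h
  rcases coeff_e_mem hi0 hip b with h1 | h1 <;> rw [h1] at h
  · exact absurd (Int.le_of_dvd one_pos h) (by omega)
  · rw [dvd_neg] at h
    exact absurd (Int.le_of_dvd one_pos h) (by omega)

/-- **[Schoof2009, Exercise 9.4]** in `ℤ[G]`: `(1 + ι) f_i = T` for `1 ≤ i ≤ p - 2`.
[cite: Schoof2009, Exercise 9.4] -/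
theorem one_add_iota_mul_f {i : ℕ} (hi0 : 0 < i) (hip : i + 1 < p) :
    (1 + iota p) * f p i = trace p := by
  ext b
  rw [add_mul, one_mul, coeff_add, Finsupp.coe_add, Pi.add_apply, coeff_iota_mul, coeff_trace]
  exact coeff_f_add_coeff_f_neg hi0 hip b

/-- `(1 - ι) T = 0` [Schoof2009, proof of Theorem 9.3]. [cite: Schoof2009, Theorem 9.3 (proof)] -/
theorem one_sub_iota_mul_trace : (1 - iota p) * trace p = 0 := by
  ext b
  rw [sub_mul, one_mul, coeff_sub, Finsupp.coe_sub, Pi.sub_apply, coeff_iota_mul, coeff_trace,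
    coeff_trace, coeff_zero, Finsupp.coe_zero, Pi.zero_apply, sub_self]

/-- `θ_{k p + i} = θ_i + k θ_p` (iterate Lemma 9.1 (i)). [cite: Schoof2009, Lemma 9.1 (i)] -/
theorem theta_mul_add (k i : ℕ) : theta p (k * p + i) = theta p i + (k : MonoidAlgebra ℤ (ZMod p)ˣ) * theta p p := by
  induction k with
  | zero => simp
  | succ k ih =>
    rw [Nat.succ_mul, Nat.add_right_comm, Nat.add_comm _ p, theta_add, ih]
    push_cast
    ring

/-! ### Membership in the Stickelberger ideal and in `I` -/

/-- `θ_i ∈ S`. [cite: Schoof2009, Ch. 9, Definition (p. 58)] -/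
theorem theta_mem (i : ℕ) : theta p i ∈ stickelbergerIdeal p :=
  Ideal.subset_span ⟨i, rfl⟩

/-- `T ∈ S` [Schoof2009, Proposition 9.2]. [cite: Schoof2009, Proposition 9.2] -/
theorem trace_mem : trace p ∈ stickelbergerIdeal p := by
  rw [trace_eq]
  exact Ideal.sub_mem _ (theta_mem _) (theta_mem _)

/-- `f_i ∈ S`. [cite: Schoof2009, Proposition 9.2] -/
theorem f_mem (i : ℕ) : f p i ∈ stickelbergerIdeal p :=
  Ideal.sub_mem _ (theta_mem _) (theta_mem _)

/-- `e_i ∈ I = S · (1 - ι)`. [cite: Schoof2009, Theorem 9.3 (ii)] -/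
theorem e_mem (i : ℕ) : e p i ∈ idealI p := by
  rw [e, mul_comm]
  exact Ideal.mul_mem_mul (f_mem i) (Ideal.subset_span rfl)

/-- `x (1 - ι) ∈ I` for `x ∈ S`. [cite: Schoof2009, Theorem 9.3 (ii)] -/
theorem mul_one_sub_iota_mem {x : MonoidAlgebra ℤ (ZMod p)ˣ} (hx : x ∈ stickelbergerIdeal p) :
    x * (1 - iota p) ∈ idealI p :=
  Ideal.mul_mem_mul hx (Ideal.subset_span rfl)

end Stickelberger

end Literature.NumberTheory.NumberFields
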